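import Summits.HodgeConjecture.HodgeConjecture.Theorems.SecondaryPeriodsRiemannWeightOneStubAlgebraisationSmoothFiniteProjection
import Summits.HodgeConjecture.HodgeConjecture.Theorems.SecondaryPeriodsRiemannWeightOneStubAlgebraisationSmoothGenericNoether
import Summits.HodgeConjecture.HodgeConjecture.Theorems.SecondaryPeriodsRiemannWeightOneStubAlgebraisationSmoothIrreducible
import Literature.AlgebraicGeometry.HodgeTheory.GAGADimensionConverse
import Mathlib.RingTheory.NoetherNormalization
import Mathlib.RingTheory.KrullDimension.NonZeroDivisors
import Mathlib.Analysis.Calculus.InverseFunctionTheorem.FDeriv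
import HarnessLib

/-!
# Crux `RiemannWeightOne` (stmt-HodgeConjecture-16406), stub `stub_algebraisationSmooth`, part (G3): a finite projection transversal at a point, and its single-sheet neighbourhood

Helper file for the registered stub `stub_algebraisationSmooth` (Serre, GAGA §2 n°6), in the
setting of part (G1) (`…StubAlgebraisationSmoothAffineChart`; `U₀ = ι⁻¹(D₊(Xᵢ))` the affine
open at `m₀`, `B = Γ(X, U₀)`):

* `Transversal.exists_noether`, `injective_aeval_of_forall_isIntegral` — a Noether normalisation
  `ℂ[s₁, …, s_e] ↪ B` with `dim B = e` (Mathlib), and injectivity of `ℂ[T] → B` for any `e`-tuple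
  `t` over which `B` is integral (a non-zero kernel would drop the dimension);
* `Transversal.le_of_forall_isIntegral` — **`n ≤ e`**: `s ∘ φ` is holomorphic with finite level
  sets, hence immersive somewhere (the tree's `GAGADimension.finrank_le_codim_add_of_finite_fibers`);
* `Transversal.exists_transversal_projection` — by part (N) applied to the point derivation of
  part (G1) (onto the cotangent space at an immersive point) there is `t : Fin e → B` with `B`
  integral over `ℂ[t]` and `d(t ∘ φ)(m₀)` injective, whence (inverse function theorem after a left
  inverse of the differential) `t ∘ φ` is INJECTIVE on an open neighbourhood of `m₀`.

## References

* [SerreGAGA1956] J.-P. Serre, GAGA, Ann. Inst. Fourier 6 (1956), §2 n°6 Prop. 3 and Cor.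
* [Chirka1989] E. M. Chirka, Complex Analytic Sets (1989), §2.7, §3.3 Prop. 1.
* [Matsumura1987] H. Matsumura, Commutative Ring Theory, Thm. 5.6.
-/

noncomputable section

set_option linter.dupNamespace false

namespace Summit.HodgeConjecture.HodgeConjecture.Theorems.RiemannWeightOne

namespace Transversal

open scoped Manifold ContDiff Topology LinearAlgebra.Projectivization nonZeroDivisors
open CategoryTheory AlgebraicGeometry Filter Set Function
open Literature.AlgebraicGeometry.Motives Literature.AlgebraicGeometry.Motives.AlgPoints
open Literature.NumberTheory.Transcendental (IsAnalytification projPoint)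
open Literature.AlgebraicGeometry.HodgeTheory
open AffineChart FiniteProjection

attribute [local instance] UniversalHyperplaneSection.sectionsAlgebra

section Algebra

variable {B : Type} [CommRing B] [IsDomain B] [Algebra ℂ B] [Algebra.FiniteType ℂ B]

/-- **Noether normalisation** of an affine `ℂ`-domain, in the elementwise form of part (N), with the
dimension: `ℂ[s₁, …, s_e] ↪ B` integral and `dim B = e`. [cite: Matsumura1987, Thm. 5.6] -/
theorem exists_noether : ∃ (e : ℕ) (s : Fin e → B),
    (∀ b : B, IsIntegral (Algebra.adjoin ℂ (Set.range s)) b) ∧ ringKrullDim B = e := by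
  obtain ⟨e, g, hinj, hint⟩ := exists_integral_inj_algHom_of_fg ℂ B
  refine ⟨e, fun i => g (MvPolynomial.X i), forall_isIntegral_of_isIntegral g hint, ?_⟩
  letI : Algebra (MvPolynomial (Fin e) ℂ) B := g.toRingHom.toAlgebra
  haveI : Algebra.IsIntegral (MvPolynomial (Fin e) ℂ) B := ⟨fun b => hint b⟩
  have hinj' : Function.Injective (algebraMap (MvPolynomial (Fin e) ℂ) B) := hinj
  rw [← Literature.RingTheory.KrullDimension.ringKrullDim_eq_of_isIntegral hinj',
    MvPolynomial.ringKrullDim_of_isNoetherianRing, ringKrullDim_eq_zero_of_field]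
  simp

omit [IsDomain B] [Algebra.FiniteType ℂ B] in
/-- **A finite tuple over which `B` is integral is algebraically free when it has `dim B` members**:
if `B` is integral over `ℂ[t₁, …, t_e]` and `dim B = e` then `ℂ[T] → B` is injective (otherwise
`B` is integral over `ℂ[T]/𝔮` with `𝔮 ∋ r ≠ 0`, of dimension `≤ e - 1`). [cite: Matsumura1987, Thm. 5.6] -/
theorem injective_aeval_of_forall_isIntegral {e : ℕ} (t : Fin e → B)
    (ht : ∀ b : B, IsIntegral (Algebra.adjoin ℂ (Set.range t)) b) (hdim : ringKrullDim B = e) :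
    Injective (MvPolynomial.aeval t : MvPolynomial (Fin e) ℂ →ₐ[ℂ] B) := by
  set A := Algebra.adjoin ℂ (Set.range t) with hA
  -- `dim A = dim B = e`
  haveI : Algebra.IsIntegral A B := ⟨ht⟩
  have hdimA : ringKrullDim A = e := by
    rw [Literature.RingTheory.KrullDimension.ringKrullDim_eq_of_isIntegral (R := A) (S := B)
      Subtype.val_injective, hdim]
  -- `A ≅ ℂ[T] / ker`
  set g : MvPolynomial (Fin e) ℂ →ₐ[ℂ] B := MvPolynomial.aeval t with hg
  have hmem : ∀ q, g q ∈ A := fun q => by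
    rw [hA, Algebra.adjoin_range_eq_range_aeval]; exact ⟨q, rfl⟩
  set ρ : MvPolynomial (Fin e) ℂ →ₐ[ℂ] A := g.codRestrict A hmem with hρ
  have hρsurj : Surjective ρ := by
    rintro ⟨a, ha⟩
    rw [hA, Algebra.adjoin_range_eq_range_aeval] at ha
    obtain ⟨q, rfl⟩ := ha
    exact ⟨q, Subtype.ext rfl⟩
  have hker : RingHom.ker (ρ : MvPolynomial (Fin e) ℂ →+* A) = RingHom.ker (g : MvPolynomial (Fin e) ℂ →+* B) := by
    ext q
    simp only [RingHom.mem_ker]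
    constructor
    · intro h; exact congrArg Subtype.val h
    · intro h; exact Subtype.ext h
  rw [injective_iff_map_eq_zero]
  intro r hr
  by_contra hr0
  -- `dim ℂ[T]/(r) + 1 ≤ e`
  have hquot : ringKrullDim (MvPolynomial (Fin e) ℂ ⧸ Ideal.span {r}) + 1 ≤ e := by
    have h := ringKrullDim_quotient_succ_le_of_nonZeroDivisor (mem_nonZeroDivisors_of_ne_zero hr0)
    rwa [MvPolynomial.ringKrullDim_of_isNoetherianRing, ringKrullDim_eq_zero_of_field, zero_add,
      Nat.card_eq_fintype_card, Fintype.card_fin] at h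
  -- `A` is a quotient of `ℂ[T]/(r)`
  have hle : Ideal.span {r} ≤ RingHom.ker (ρ : MvPolynomial (Fin e) ℂ →+* A) := by
    rw [Ideal.span_le, Set.singleton_subset_iff, SetLike.mem_coe, hker, RingHom.mem_ker]
    exact hr
  have hsurj : Surjective (Ideal.Quotient.lift (Ideal.span {r}) (ρ : MvPolynomial (Fin e) ℂ →+* A)
      fun q hq => hle hq) := by
    intro a
    obtain ⟨q, rfl⟩ := hρsurj a
    exact ⟨Ideal.Quotient.mk _ q, by simp⟩
  have hAle := ringKrullDim_le_of_surjective _ hsurj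
  rw [hdimA] at hAle
  -- contradiction: `e + 1 ≤ e`
  have h2 : (e : WithBot ℕ∞) + 1 ≤ e := le_trans (add_le_add hAle le_rfl) hquot
  have h3 : ((e + 1 : ℕ) : WithBot ℕ∞) ≤ (e : ℕ) := by exact_mod_cast h2
  have h4 : e + 1 ≤ e := by exact_mod_cast h3
  omega

end Algebra

section Setting

variable {n : ℕ} {M : Type} {X : SchemeOver ℂ}

/-- The tuple map `m ↦ (t₁(φ m), …, t_e(φ m))` of regular functions along `φ`. [folklore] -/
def tupleMap (φ : M → ComplexPoints X) (U : X.left.affineOpens) {e : ℕ} (t : Fin e → Γ(X.left, ↑U)) :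
    M → (Fin e → ℂ) :=
  fun m k => evalOrZero ↑U (t k) (φ m)

variable {φ : M → ComplexPoints X}

/-- Unfolding the tuple map at a point of `U(ℂ)`. [folklore] -/
theorem tupleMap_apply_of_mem (U : X.left.affineOpens) {e : ℕ} (t : Fin e → Γ(X.left, ↑U)) {m : M}
    (hm : (φ m).pt ∈ (↑U : X.left.Opens)) :
    tupleMap φ U t m = fun k => (φ m).eval ↑U hm (t k) :=
  funext fun _ => evalOrZero_of_mem _ hm

variable [TopologicalSpace M] [ChartedSpace (Fin n → ℂ) M] (hφ : IsAnalytification (Fin n → ℂ) X n φ)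

include hφ in
/-- The tuple map is holomorphic on `φ⁻¹(U(ℂ))`. [cite: SerreGAGA1956, §2 n°5 Prop. 2] -/
theorem mdifferentiableOn_tupleMap (U : X.left.affineOpens) {e : ℕ} (t : Fin e → Γ(X.left, ↑U)) :
    MDifferentiableOn 𝓘(ℂ, Fin n → ℂ) 𝓘(ℂ, Fin e → ℂ) (tupleMap φ U t)
      (φ ⁻¹' {P | P.pt ∈ (↑U : X.left.Opens)}) :=
  Literature.Geometry.Kaehler.mdifferentiableOn_pi_space.2 fun k => hφ.mdifferentiableOn_evalOrZero U (t k)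

include hφ in
/-- The tuple map is continuous at points of `φ⁻¹(U(ℂ))`. [folklore] -/
theorem continuousAt_tupleMap (U : X.left.affineOpens) {e : ℕ} (t : Fin e → Γ(X.left, ↑U)) {m : M}
    (hm : (φ m).pt ∈ (↑U : X.left.Opens)) : ContinuousAt (tupleMap φ U t) m := by
  have hcont : ContinuousOn (tupleMap φ U t) (φ ⁻¹' {P | P.pt ∈ (↑U : X.left.Opens)}) :=
    (AlgPoints.continuousOn_evalOrZero_pi t).comp hφ.isHomeomorph.continuous.continuousOn
      (fun _ h => h)
  exact hcont.continuousAt ((hφ.isOpen_preimage ↑U).mem_nhds hm)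

end Setting

section AtPoint

variable {n N' : ℕ} {M : Type} [TopologicalSpace M] [ChartedSpace (Fin n → ℂ) M]
  [IsManifold 𝓘(ℂ, Fin n → ℂ) ω M]
  {X : SchemeOver ℂ} (ι : X ⟶ projectiveSpace (N' + 1) ℂ) [IsClosedImmersion ι.left]
  {φ : M → ComplexPoints X} (hφ : IsAnalytification (Fin n → ℂ) X n φ)
  (F : M → ℙ ℂ (Fin (N' + 2) → ℂ)) (hcomp : ∀ m, AlgPoints.map ι (φ m) = projPoint (N' + 1) (F m))
  (m₀ : M)

omit [TopologicalSpace M] [ChartedSpace (Fin n → ℂ) M] [IsManifold 𝓘(ℂ, Fin n → ℂ) ω M] in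
include ι in
/-- A closed subscheme of projective space is locally of finite type over `ℂ`. [folklore] -/
theorem locallyOfFiniteType : LocallyOfFiniteType X.hom := by
  haveI : IsProper X.hom := by rw [← Over.w ι]; infer_instance
  infer_instance

include hφ hcomp in
/-- **`B = Γ(X, U₀)` is a domain** (`X` is reduced and, being analytified by the connected `M`,
irreducible — part (I)). [cite: SerreGAGA1956, §2 n°5 Lemme 1 b)] -/
theorem isDomain_sections [IsReduced X.left] [ConnectedSpace M] :
    IsDomain Γ(X.left, ↑(affineOpenAt ι F m₀)) := by
  haveI := locallyOfFiniteType ι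
  haveI : IsIntegral X.left := isIntegral_of_isAnalytification hφ
  haveI : Nonempty (↑(affineOpenAt ι F m₀) : X.left.Opens) :=
    ⟨⟨(φ m₀).pt, pt_mem_affineOpenAt ι F hcomp m₀⟩⟩
  infer_instance

include hφ hcomp in
/-- **`n ≤ e` for a tuple of `e` regular functions over which `B` is integral**: the tuple map is
holomorphic with finite level sets on `φ⁻¹(U₀(ℂ))` (finite fibres of the finite projection), so
it is immersive somewhere (`GAGADimension.finrank_le_codim_add_of_finite_fibers` with `S = M`,
regular of codimension `0` at `m₀`). [cite: Chirka1989, §2.7 and §3.3 Prop. 1] -/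
theorem le_of_forall_isIntegral {e : ℕ} (s : Fin e → Γ(X.left, ↑(affineOpenAt ι F m₀)))
    (hs : ∀ b : Γ(X.left, ↑(affineOpenAt ι F m₀)), IsIntegral (Algebra.adjoin ℂ (Set.range s)) b) :
    n ≤ e := by
  haveI := locallyOfFiniteType ι
  haveI : IsManifold 𝓘(ℂ, Fin n → ℂ) 1 M := IsManifold.of_le (n := ω) le_top
  have hWo : IsOpen (φ ⁻¹' {P | P.pt ∈ (↑(affineOpenAt ι F m₀) : X.left.Opens)}) :=
    hφ.isOpen_preimage _
  have hm₀W : m₀ ∈ φ ⁻¹' {P | P.pt ∈ (↑(affineOpenAt ι F m₀) : X.left.Opens)} :=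
    pt_mem_affineOpenAt ι F hcomp m₀
  have hΘ := mdifferentiableOn_tupleMap hφ (affineOpenAt ι F m₀) s
  have hfin : ∀ c, ((Set.univ : Set M) ∩ φ ⁻¹' {P | P.pt ∈ (↑(affineOpenAt ι F m₀) : X.left.Opens)} ∩
      tupleMap φ (affineOpenAt ι F m₀) s ⁻¹' {c}).Finite := by
    intro c
    refine ((finite_setOf_eval_eq (affineOpenAt ι F m₀) s hs c).preimage
      hφ.isHomeomorph.injective.injOn).subset ?_
    rintro m ⟨⟨-, hmW⟩, hmc⟩
    refine ⟨hmW, ?_⟩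
    rw [Set.mem_preimage, Set.mem_singleton_iff, tupleMap_apply_of_mem _ s hmW] at hmc
    exact hmc
  have hreg : Literature.Geometry.Kaehler.IsRegularPointOfCodim 𝓘(ℂ, Fin n → ℂ) (Set.univ : Set M) 0 m₀ := by
    refine ⟨Set.univ, isOpen_univ, trivial, fun _ => 0, mdifferentiableOn_const, ?_, ?_⟩
    · ext m; simp
    · exact fun v => ⟨0, funext fun i => Fin.elim0 i⟩
  have h := GAGADimension.finrank_le_codim_add_of_finite_fibers hWo hΘ hfin (Set.mem_univ m₀) hm₀W hreg
  simpa using h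

include hcomp in
/-- **The point derivation is onto the cotangent space** at an immersive point: its values on the
affine coordinate functions already span (part (G1)). [cite: SerreGAGA1956, §2 n°6] -/
theorem surjective_pointDerivation
    (hFd : MDifferentiableAt 𝓘(ℂ, Fin n → ℂ) 𝓘(ℂ, Fin (N' + 1) → ℂ) F m₀)
    (hdF : Injective (mfderiv 𝓘(ℂ, Fin n → ℂ) 𝓘(ℂ, Fin (N' + 1) → ℂ) F m₀)) :
    Surjective (pointDerivation hφ m₀ (affineOpenAt ι F m₀) (pt_mem_affineOpenAt ι F hcomp m₀)) := by
  set δ := pointDerivation hφ m₀ (affineOpenAt ι F m₀) (pt_mem_affineOpenAt ι F hcomp m₀) with hδ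
  have hspan := span_pointDerivation_coordFn_eq_top ι hφ F hcomp m₀ hFd hdF
  rw [← LinearMap.range_eq_top, eq_top_iff, ← hspan, Submodule.span_le]
  rintro _ ⟨j, rfl⟩
  exact ⟨coordFn ι F m₀ j, rfl⟩

include hcomp in
/-- **Directions**: for `e ≥ n` there are `w₁, …, w_e ∈ B` whose differentials span the cotangent
space (choose preimages of the coordinate functionals under the surjective `δ`, pad with `0`).
[folklore] -/
theorem exists_directions
    (hFd : MDifferentiableAt 𝓘(ℂ, Fin n → ℂ) 𝓘(ℂ, Fin (N' + 1) → ℂ) F m₀)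
    (hdF : Injective (mfderiv 𝓘(ℂ, Fin n → ℂ) 𝓘(ℂ, Fin (N' + 1) → ℂ) F m₀)) {e : ℕ} (hne : n ≤ e) :
    ∃ w : Fin e → Γ(X.left, ↑(affineOpenAt ι F m₀)), Submodule.span ℂ (Set.range fun l =>
      pointDerivation hφ m₀ (affineOpenAt ι F m₀) (pt_mem_affineOpenAt ι F hcomp m₀) (w l)) = ⊤ := by
  classical
  set δ := pointDerivation hφ m₀ (affineOpenAt ι F m₀) (pt_mem_affineOpenAt ι F hcomp m₀) with hδ
  have hsurj := surjective_pointDerivation ι hφ F hcomp m₀ hFd hdF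
  choose b hb using fun i : Fin n => hsurj (ContinuousLinearMap.proj i)
  refine ⟨fun l => if h : (l : ℕ) < n then b ⟨l, h⟩ else 0, ?_⟩
  rw [eq_top_iff, ← span_proj_eq_top, Submodule.span_le]
  rintro _ ⟨i, rfl⟩
  refine Submodule.subset_span ⟨⟨i, lt_of_lt_of_le i.2 hne⟩, ?_⟩
  change δ (if h : ((⟨i, lt_of_lt_of_le i.2 hne⟩ : Fin e) : ℕ) < n then b ⟨_, h⟩ else 0) = _
  rw [dif_pos (show (i : ℕ) < n from i.2)]
  exact hb i

include hcomp in
/-- **The transversal finite projection**: `t : Fin e → B` with `B` integral over `ℂ[t]` and the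
differentials `δ(tₖ)` spanning the cotangent space (part (N) applied to `δ`). [cite: SerreGAGA1956, §2 n°6] -/
theorem exists_transversal
    (hFd : MDifferentiableAt 𝓘(ℂ, Fin n → ℂ) 𝓘(ℂ, Fin (N' + 1) → ℂ) F m₀)
    (hdF : Injective (mfderiv 𝓘(ℂ, Fin n → ℂ) 𝓘(ℂ, Fin (N' + 1) → ℂ) F m₀)) {e : ℕ} (hne : n ≤ e)
    (s : Fin e → Γ(X.left, ↑(affineOpenAt ι F m₀)))
    (hs : ∀ b : Γ(X.left, ↑(affineOpenAt ι F m₀)), IsIntegral (Algebra.adjoin ℂ (Set.range s)) b) :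
    ∃ t : Fin e → Γ(X.left, ↑(affineOpenAt ι F m₀)),
      (∀ b : Γ(X.left, ↑(affineOpenAt ι F m₀)), IsIntegral (Algebra.adjoin ℂ (Set.range t)) b) ∧ Submodule.span ℂ (Set.range fun k =>
        pointDerivation hφ m₀ (affineOpenAt ι F m₀) (pt_mem_affineOpenAt ι F hcomp m₀) (t k)) = ⊤ := by
  obtain ⟨w, hw⟩ := exists_directions ι hφ F hcomp m₀ hFd hdF hne
  set δ := pointDerivation hφ m₀ (affineOpenAt ι F m₀) (pt_mem_affineOpenAt ι F hcomp m₀) with hδ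
  obtain ⟨t, ht, hspan⟩ := GenericNoether.exists_forall_isIntegral_span δ
    (evalAlgHom (affineOpenAt ι F m₀) (φ m₀) (pt_mem_affineOpenAt ι F hcomp m₀))
    (pointDerivation_mul hφ m₀ (affineOpenAt ι F m₀) (pt_mem_affineOpenAt ι F hcomp m₀)) w s hs
  refine ⟨t, ht, ?_⟩
  rw [eq_top_iff, ← hw, Submodule.span_le]
  rintro _ ⟨l, rfl⟩
  exact hspan l

include hcomp in
/-- **The single-sheet neighbourhood**: if the differentials `δ(tₖ)` span the cotangent space then
the tuple map `t ∘ φ` is injective on an open neighbourhood `W ⊆ φ⁻¹(U₀(ℂ))` of `m₀` (its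
chart expression has injective differential, hence a left inverse `L`; `L ∘ (t ∘ φ ∘ chart⁻¹)` has
the identity as strict differential and is injective near `chart m₀` by the inverse function
theorem). [folklore] -/
theorem exists_injOn_nhds {e : ℕ} (t : Fin e → Γ(X.left, ↑(affineOpenAt ι F m₀)))
    (hspan : Submodule.span ℂ (Set.range fun k =>
      pointDerivation hφ m₀ (affineOpenAt ι F m₀) (pt_mem_affineOpenAt ι F hcomp m₀) (t k)) = ⊤) :
    ∃ W : Set M, IsOpen W ∧ m₀ ∈ W ∧ W ⊆ φ ⁻¹' {P | P.pt ∈ (↑(affineOpenAt ι F m₀) : X.left.Opens)} ∧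
      InjOn (tupleMap φ (affineOpenAt ι F m₀) t) W := by
  have hm₀ : (φ m₀).pt ∈ (↑(affineOpenAt ι F m₀) : X.left.Opens) := pt_mem_affineOpenAt ι F hcomp m₀
  set ec := chartOfAnalytification hφ m₀ with hec
  set c₀ := chartAt (Fin n → ℂ) m₀ m₀ with hc₀
  -- the chart expression and its strict differential
  set Θc : (Fin n → ℂ) → (Fin e → ℂ) := fun z k => (evalOrZero ↑(affineOpenAt ι F m₀) (t k) ∘ ec.symm) z with hΘc
  set A : (Fin n → ℂ) →L[ℂ] (Fin e → ℂ) := ContinuousLinearMap.pi fun k =>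
    pointDerivation hφ m₀ (affineOpenAt ι F m₀) hm₀ (t k) with hA
  have hnhds : ec.target ∩ ec.symm ⁻¹' {Q | Q.pt ∈ (↑(affineOpenAt ι F m₀) : X.left.Opens)} ∈ 𝓝 c₀ := by
    have h := GAGADimension.chart_nhds ec (mem_chartOfAnalytification_source hφ m₀) hm₀
    rwa [chartOfAnalytification_apply] at h
  have hstrict : HasStrictFDerivAt Θc A c₀ := by
    rw [hΘc, hA, hasStrictFDerivAt_pi]
    intro k
    have hcd : ContDiffAt ℂ ω (evalOrZero ↑(affineOpenAt ι F m₀) (t k) ∘ ec.symm) c₀ :=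
      (contDiffOn_chartOfAnalytification hφ m₀ (affineOpenAt ι F m₀) (t k)).contDiffAt hnhds
    have h := hcd.hasStrictFDerivAt (by simp)
    rwa [← pointDerivation_apply hφ m₀ (affineOpenAt ι F m₀) hm₀ (t k)] at h
  -- `A` is injective, with a continuous left inverse
  have hAinj : Injective A := by
    have h := injective_pi_of_span_eq_top _ hspan
    intro x y hxy
    exact h (funext fun k => by have := congrFun hxy k; simpa [hA] using this)
  obtain ⟨L, hL⟩ := (A : (Fin n → ℂ) →ₗ[ℂ] (Fin e → ℂ)).exists_leftInverse_of_injective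
    (LinearMap.ker_eq_bot.2 hAinj)
  set Lc : (Fin e → ℂ) →L[ℂ] (Fin n → ℂ) := LinearMap.toContinuousLinearMap L with hLc
  have hcomp' : Lc.comp A = ((ContinuousLinearEquiv.refl ℂ (Fin n → ℂ) : (Fin n → ℂ) ≃L[ℂ] (Fin n → ℂ)) :
      (Fin n → ℂ) →L[ℂ] (Fin n → ℂ)) := by
    ext x i
    have := congrArg (fun f : (Fin n → ℂ) →ₗ[ℂ] (Fin n → ℂ) => f x i) hL
    simpa [hLc] using this
  have hstrict' : HasStrictFDerivAt (Lc ∘ Θc)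
      ((ContinuousLinearEquiv.refl ℂ (Fin n → ℂ) : (Fin n → ℂ) ≃L[ℂ] (Fin n → ℂ)) :
        (Fin n → ℂ) →L[ℂ] (Fin n → ℂ)) c₀ := by
    rw [← hcomp']
    exact Lc.hasStrictFDerivAt.comp c₀ hstrict
  set ph := hstrict'.toOpenPartialHomeomorph (Lc ∘ Θc) with hph
  have hc₀S : c₀ ∈ ph.source := hstrict'.mem_toOpenPartialHomeomorph_source
  have hinjΘc : InjOn Θc ph.source := fun z hz z' hz' hzz' => by
    have h : ph z = ph z' := by
      change (Lc ∘ Θc) z = (Lc ∘ Θc) z'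
      simp only [Function.comp_apply, hzz']
    exact ph.injOn hz hz' h
  -- the neighbourhood
  refine ⟨φ ⁻¹' {P | P.pt ∈ (↑(affineOpenAt ι F m₀) : X.left.Opens)} ∩ ((chartAt (Fin n → ℂ) m₀).source ∩
      chartAt (Fin n → ℂ) m₀ ⁻¹' ph.source), ?_, ⟨hm₀, mem_chart_source _ m₀, hc₀S⟩,
    Set.inter_subset_left, ?_⟩
  · exact (hφ.isOpen_preimage ↑(affineOpenAt ι F m₀)).inter ((chartAt (Fin n → ℂ) m₀).isOpen_inter_preimage ph.open_source)
  · rintro m ⟨hmU, hms, hmS⟩ m' ⟨hm'U, hm's, hm'S⟩ hmm'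
    have key : ∀ {x}, x ∈ (chartAt (Fin n → ℂ) m₀).source →
        Θc (chartAt (Fin n → ℂ) m₀ x) = tupleMap φ (affineOpenAt ι F m₀) t x := fun {x} hx => by
      funext k
      simp only [hΘc, hec, Function.comp_apply, chartOfAnalytification_symm_apply,
        (chartAt (Fin n → ℂ) m₀).left_inv hx]
      rfl
    have h : Θc (chartAt (Fin n → ℂ) m₀ m) = Θc (chartAt (Fin n → ℂ) m₀ m') := by
      rw [key hms, key hm's, hmm']
    exact (chartAt (Fin n → ℂ) m₀).injOn hms hm's (hinjΘc hmS hm'S h)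

include hφ hcomp in
/-- **Summary of part (G3).** At every point `m₀`, for `F` differentiable at `m₀` with injective
differential, `X` reduced and `M` connected: there are `e ≥ n` and `t : Fin e → B = Γ(X, U₀)` with
`B` a domain of dimension `e`, integral over `ℂ[t]` with `ℂ[T] → B` injective, and an open
neighbourhood `W ⊆ φ⁻¹(U₀(ℂ))` of `m₀` on which `t ∘ φ` is injective. [cite: SerreGAGA1956, §2 n°6] -/
theorem exists_transversal_projection [IsReduced X.left] [ConnectedSpace M]
    (hFd : MDifferentiableAt 𝓘(ℂ, Fin n → ℂ) 𝓘(ℂ, Fin (N' + 1) → ℂ) F m₀)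
    (hdF : Injective (mfderiv 𝓘(ℂ, Fin n → ℂ) 𝓘(ℂ, Fin (N' + 1) → ℂ) F m₀)) :
    ∃ (e : ℕ) (t : Fin e → Γ(X.left, ↑(affineOpenAt ι F m₀))), n ≤ e ∧
      (∀ b : Γ(X.left, ↑(affineOpenAt ι F m₀)), IsIntegral (Algebra.adjoin ℂ (Set.range t)) b) ∧
      Injective (MvPolynomial.aeval t : MvPolynomial (Fin e) ℂ →ₐ[ℂ] Γ(X.left, ↑(affineOpenAt ι F m₀))) ∧
      ringKrullDim Γ(X.left, ↑(affineOpenAt ι F m₀)) = e ∧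
      ∃ W : Set M, IsOpen W ∧ m₀ ∈ W ∧ W ⊆ φ ⁻¹' {P | P.pt ∈ (↑(affineOpenAt ι F m₀) : X.left.Opens)} ∧
        InjOn (tupleMap φ (affineOpenAt ι F m₀) t) W := by
  haveI := locallyOfFiniteType ι
  haveI := isDomain_sections ι hφ F hcomp m₀
  haveI : Algebra.FiniteType ℂ Γ(X.left, ↑(affineOpenAt ι F m₀)) := finiteType_sections _
  obtain ⟨e, s, hs, hdim⟩ := exists_noether (B := Γ(X.left, ↑(affineOpenAt ι F m₀)))
  have hne : n ≤ e := le_of_forall_isIntegral ι hφ F hcomp m₀ s hs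
  obtain ⟨t, ht, hspan⟩ := exists_transversal ι hφ F hcomp m₀ hFd hdF hne s hs
  obtain ⟨W, hWo, hm₀W, hWU, hinj⟩ := exists_injOn_nhds ι hφ F hcomp m₀ t hspan
  exact ⟨e, t, hne, ht, injective_aeval_of_forall_isIntegral t ht hdim, hdim, W, hWo, hm₀W, hWU, hinj⟩

end AtPoint

end Transversal

open scoped Manifold ContDiff LinearAlgebra.Projectivization in
open CategoryTheory AlgebraicGeometry Literature.AlgebraicGeometry.Motives
  Literature.NumberTheory.Transcendental AffineChart Transversal in
attribute [local instance] UniversalHyperplaneSection.sectionsAlgebra in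
/-- **Registered sub-goal `stub_algebraisationSmooth_transversal`** of the stub
`stub_algebraisationSmooth` (part (G3), `Transversal.exists_transversal_projection`).
[cite: SerreGAGA1956, §2 n°6 Prop. 3 and Cor.] -/
theorem stub_algebraisationSmooth_transversal :
    ∀ ⦃n N' : ℕ⦄ ⦃M : Type⦄ [TopologicalSpace M] [ChartedSpace (Fin n → ℂ) M]
      [IsManifold 𝓘(ℂ, Fin n → ℂ) ω M] [ConnectedSpace M] ⦃X : SchemeOver ℂ⦄
      (ι : X ⟶ projectiveSpace (N' + 1) ℂ) [IsClosedImmersion ι.left] [IsReduced X.left]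
      ⦃φ : M → ComplexPoints X⦄ (hφ : IsAnalytification (Fin n → ℂ) X n φ)
      (F : M → ℙ ℂ (Fin (N' + 2) → ℂ)) (hcomp : ∀ m, AlgPoints.map ι (φ m) = projPoint (N' + 1) (F m))
      (m₀ : M), MDifferentiableAt 𝓘(ℂ, Fin n → ℂ) 𝓘(ℂ, Fin (N' + 1) → ℂ) F m₀ →
      Function.Injective (mfderiv 𝓘(ℂ, Fin n → ℂ) 𝓘(ℂ, Fin (N' + 1) → ℂ) F m₀) →
      ∃ (e : ℕ) (t : Fin e → Γ(X.left, ↑(affineOpenAt ι F m₀))), n ≤ e ∧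
        (∀ b : Γ(X.left, ↑(affineOpenAt ι F m₀)), IsIntegral (Algebra.adjoin ℂ (Set.range t)) b) ∧
        Function.Injective (MvPolynomial.aeval t : MvPolynomial (Fin e) ℂ →ₐ[ℂ] Γ(X.left, ↑(affineOpenAt ι F m₀))) ∧
        ringKrullDim Γ(X.left, ↑(affineOpenAt ι F m₀)) = e ∧
        ∃ W : Set M, IsOpen W ∧ m₀ ∈ W ∧ W ⊆ φ ⁻¹' {P | P.pt ∈ (↑(affineOpenAt ι F m₀) : X.left.Opens)} ∧
          Set.InjOn (tupleMap φ (affineOpenAt ι F m₀) t) W :=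
  fun _ _ _ _ _ _ _ _ ι _ _ _ hφ F hcomp m₀ hFd hdF =>
    Transversal.exists_transversal_projection ι hφ F hcomp m₀ hFd hdF

end Summit.HodgeConjecture.HodgeConjecture.Theorems.RiemannWeightOne

end
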